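import Summits.AtomisticToContinuum.HydrodynamicLimit.Theses.MourreKoopmanCharges
import Summits.AtomisticToContinuum.HydrodynamicLimit.Theorems.MourreKoopmanChargesStressStrongMixingTorusStatics
import Summits.AtomisticToContinuum.HydrodynamicLimit.Theorems.MourreKoopmanChargesStressStrongMixingStressAutocorrelationZero
import HarnessLib

/-!
# `StressStrongMixing` (stmt-AtomisticToContinuum-9584) — the typed THREE-WAY SPLIT and its glue

Support file for the crux item stmt-AtomisticToContinuum-9584 (`StressStrongMixing`, rank 5 of route
`MourreKoopmanCharges`, sub-problem `AtomisticToContinuum/HydrodynamicLimit`), filed by the crux strategist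
(`cstrat-stmt-AtomisticToContinuum-9584-s1`) to promote the load-bearing cut of the live line `birth`
(`Cruxes/StressStrongMixing/Lines/birth.lean`, lead c4; its `StressStrongMixing_of_direct`) to ROUTE LEVEL.

The crux asks for `c : ℝ → ℝ` with `c(s) → 0` such that, for every flow family `Φ`, continuous `χ₁, χ₂` on `𝕋³`
and `s ≥ 0`, `M_N(s) := (N+1)·E_{G_N}[Π(χ₁)(Φ_{s(N+1)^{-1/3}} z)·Π(χ₂)(z)] → c(s)·∫χ₁χ₂`
(`Π(χ)(z) = (N+1)⁻¹ Σᵢ χ(xᵢ) vᵢ⁰vᵢ¹`, canonical law at rest `G_N = localGibbsLaw σ 1 0 θ N (Φ N)`).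
Since the torus moments determine `c`, EVERY proof consists of (i) the finite → infinite-volume identification of
`lim_N M_N(s)` and (ii) the decay of that limit at FIXED reduced diameter `σ`.  Over the landed carriers
(`HardSphereFluctuationData`, `.koopman`, `.fluct`, `cellObs`, `cellCharge`, `IsHardSphereGibbs`,
`InfiniteHardSphereFlow.IsEquilibriumFlow`) the three sub-cruxes are:

* `StressFrameworkDensityOne` (A — EXISTENCE of Spohn's `ℋ` at density one): for all small `σ` and every `θ` there are an
  activity `z` and hard-sphere fluctuation data `F` whose state is the DLR Gibbs state `(σ, z, θ⁻¹, 0)` of density one, whose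
  flow is a.e. an equilibrium Alexander flow and whose local observables (flow- and shift-stable, with SUMMABLE truncated
  correlations) contain the kinetic shear stress of the unit cell.  Content: Ruelle's low-activity state (landed), Alexander's
  flow (`InfiniteHardSphereFlow.nonempty`), and space–time clustering of the dilute infinite dynamics (open at fixed packing);
* `TorusStressIdentificationAll` (B — finite → infinite volume, `s > 0`): on EVERY such framework the crux's torus moment
  converges to `⟪U_s ξ_Π, ξ_Π⟫_ℋ · ∫χ₁χ₂` (two-time local limit in law of the blown-up canonical torus gas + equivalence of
  ensembles; Spohn 1991 Part I (7.14)–(7.15));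
* `StressRajchmanDecay` (C — the decay, infinite volume): on every such framework `⟪U_s ξ_Π, ξ_Π⟫_ℋ → 0` as `s → ∞`
  (Rajchman property of the spectral measure of the stress class under the Koopman group; Spohn 1991 Part I §7.1, §8.3).

`StressStrongMixing_of_subs : A → B → C → StressStrongMixing` is PROVED here (`σ₀ := min (min σ_A (min σ_B σ_C)) (1/2)`,
`c := c_F` for the framework `F` of A; `s > 0` by B at that `F`; `s = 0` by the landed statics `torusStressMoment_zero`
(`M_N(0) = θ²∫χ₁χ₂` for every `N`, p-landed `Theorems/…TorusStatics.lean`) and the landed `stub_stressAutocorrelationZero`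
(`c_F(0) = θ²`, p158174); decay by C).  No piece is the crux reworded: A has neither torus nor decay, B is conditional on a
framework and has no decay, C is conditional and has no torus; B ∧ C without A is consistent with NO framework existing.

References: H. Spohn, *Large Scale Dynamics of Interacting Particles* (1991), Part I §7.1 (7.4)–(7.15), §8.3;
R. Alexander, Comm. Math. Phys. 49 (1976) 217–232; D. Ruelle, *Statistical Mechanics* (1969) Thm 4.2.3.
-/

open MeasureTheory ProbabilityTheory Filter Topology
open scoped InnerProductSpace

namespace Summit.AtomisticToContinuum.HydrodynamicLimit.Theorems.MourreKoopmanChargesStressStrongMixingSplit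

open Literature.MathematicalPhysics.KineticTheory Literature.Analysis.FluidPDE

/-- **The three sub-cruxes A, B, C imply the crux `StressStrongMixing` BY NAME** (hypotheses written out verbatim, in
the order A `StressFrameworkDensityOne`, B `TorusStressIdentificationAll`, C `StressRajchmanDecay` of the module docstring;
`σ₀ := min (min σ_A (min σ_B σ_C)) (1/2)`; `c := c_F` for the framework `F` delivered by A; decay by C; convergence for
`s > 0` by B at that `F`; at `s = 0` the torus moment is `θ²∫χ₁χ₂` for every `N` (landed `torusStressMoment_zero`, `σ ≤ 1/2`)
and `c_F(0) = θ²` (landed `stub_stressAutocorrelationZero`), so the constant sequence converges). [folklore] -/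
theorem StressStrongMixing_of_subs
    (hA : (∃ σ₀ : ℝ, 0 < σ₀ ∧ ∀ σ : ℝ, 0 < σ → σ < σ₀ → ∀ θ : ℝ, 0 < θ →
      ∃ z : ℝ, 0 < z ∧ ∃ F : HardSphereFluctuationData σ,
        IsHardSphereGibbs σ z θ⁻¹ (0 : V3) F.μ ∧
        (∫ ω, cellCharge 0 ω ∂F.μ = 1) ∧
        (∃ Φ : InfiniteHardSphereFlow (Fin 3) σ, Φ.IsEquilibriumFlow ∧ ∀ t : ℝ, F.flow t =ᵐ[F.μ] Φ.flow t) ∧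
        cellObs (fun v : V3 => v 0 * v 1) ∈ F.localObs))
    (hB : (∃ σ₀ : ℝ, 0 < σ₀ ∧ ∀ σ : ℝ, 0 < σ → σ < σ₀ → ∀ θ : ℝ, 0 < θ → ∀ z : ℝ, 0 < z →
      ∀ F : HardSphereFluctuationData σ,
        (IsHardSphereGibbs σ z θ⁻¹ (0 : V3) F.μ ∧
          (∫ ω, cellCharge 0 ω ∂F.μ = 1) ∧
          (∃ Φ : InfiniteHardSphereFlow (Fin 3) σ, Φ.IsEquilibriumFlow ∧ ∀ t : ℝ, F.flow t =ᵐ[F.μ] Φ.flow t) ∧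
          cellObs (fun v : V3 => v 0 * v 1) ∈ F.localObs) →
        ∀ Φ : (N : ℕ) → HardSphereFlow (Torus.geometry (Fin 3)) (hsDiameter σ N) (N + 1),
        ∀ χ₁ χ₂ : T3 → ℝ, Continuous χ₁ → Continuous χ₂ → ∀ s : ℝ, 0 < s →
          Tendsto (fun N : ℕ => ((N : ℝ) + 1) * ∫ z, (∫ y, χ₁ y.1 * (y.2 0 * y.2 1)
              ∂(empiricalMeasure ((Φ N).flow (s * ((N : ℝ) + 1) ^ (-(1 / 3 : ℝ))) z))) *
            (∫ y, χ₂ y.1 * (y.2 0 * y.2 1) ∂(empiricalMeasure z))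
            ∂(localGibbsLaw σ (fun _ => 1) (fun _ => 0) (fun _ => θ) N (Φ N))) atTop
            (𝓝 (⟪F.koopman s (F.fluct (cellObs fun v : V3 => v 0 * v 1)),
                  F.fluct (cellObs fun v : V3 => v 0 * v 1)⟫_ℝ * ∫ x, χ₁ x * χ₂ x))))
    (hC : (∃ σ₀ : ℝ, 0 < σ₀ ∧ ∀ σ : ℝ, 0 < σ → σ < σ₀ → ∀ θ : ℝ, 0 < θ → ∀ z : ℝ, 0 < z →
      ∀ F : HardSphereFluctuationData σ,
        (IsHardSphereGibbs σ z θ⁻¹ (0 : V3) F.μ ∧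
          (∫ ω, cellCharge 0 ω ∂F.μ = 1) ∧
          (∃ Φ : InfiniteHardSphereFlow (Fin 3) σ, Φ.IsEquilibriumFlow ∧ ∀ t : ℝ, F.flow t =ᵐ[F.μ] Φ.flow t) ∧
          cellObs (fun v : V3 => v 0 * v 1) ∈ F.localObs) →
        Tendsto (fun s : ℝ => ⟪F.koopman s (F.fluct (cellObs fun v : V3 => v 0 * v 1)),
            F.fluct (cellObs fun v : V3 => v 0 * v 1)⟫_ℝ) atTop (𝓝 0))) :
    Summit.AtomisticToContinuum.HydrodynamicLimit.Theses.MourreKoopmanCharges.StressStrongMixing := by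
  obtain ⟨σ₁, hσ₁, H₁⟩ := hA
  obtain ⟨σ₂, hσ₂, H₂⟩ := hB
  obtain ⟨σ₃, hσ₃, H₃⟩ := hC
  refine ⟨min (min σ₁ (min σ₂ σ₃)) (1 / 2), lt_min (lt_min hσ₁ (lt_min hσ₂ hσ₃)) (by norm_num), ?_⟩
  intro σ hσ hσlt θ hθ
  have h₁ : σ < σ₁ := lt_of_lt_of_le hσlt ((min_le_left _ _).trans (min_le_left _ _))
  have h₂ : σ < σ₂ := lt_of_lt_of_le hσlt ((min_le_left _ _).trans ((min_le_right _ _).trans (min_le_left _ _)))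
  have h₃ : σ < σ₃ := lt_of_lt_of_le hσlt ((min_le_left _ _).trans ((min_le_right _ _).trans (min_le_right _ _)))
  have hhalf : σ ≤ 1 / 2 := (lt_of_lt_of_le hσlt (min_le_right _ _)).le
  obtain ⟨z, hz, F, hF⟩ := H₁ σ hσ h₁ θ hθ
  refine ⟨fun s : ℝ => ⟪F.koopman s (F.fluct (cellObs fun v : V3 => v 0 * v 1)),
      F.fluct (cellObs fun v : V3 => v 0 * v 1)⟫_ℝ, H₃ σ hσ h₃ θ hθ z hz F hF, ?_⟩
  intro Φ χ₁ χ₂ hχ₁ hχ₂ s hs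
  rcases hs.lt_or_eq with hs' | hs'
  · exact H₂ σ hσ h₂ θ hθ z hz F hF Φ χ₁ χ₂ hχ₁ hχ₂ s hs'
  · subst hs'
    have hc0 : ⟪F.koopman 0 (F.fluct (cellObs fun v : V3 => v 0 * v 1)),
        F.fluct (cellObs fun v : V3 => v 0 * v 1)⟫_ℝ = θ ^ 2 :=
      Summit.AtomisticToContinuum.HydrodynamicLimit.Theorems.MourreKoopmanChargesStressStrongMixing.stub_stressAutocorrelationZero
        σ θ z hσ hθ hz F hF
    have hconst : ∀ N : ℕ, ((N : ℝ) + 1) * ∫ z, (∫ y, χ₁ y.1 * (y.2 0 * y.2 1)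
            ∂(empiricalMeasure ((Φ N).flow (0 * ((N : ℝ) + 1) ^ (-(1 / 3 : ℝ))) z))) *
          (∫ y, χ₂ y.1 * (y.2 0 * y.2 1) ∂(empiricalMeasure z))
          ∂(localGibbsLaw σ (fun _ => 1) (fun _ => 0) (fun _ => θ) N (Φ N)) =
        θ ^ 2 * ∫ x, χ₁ x * χ₂ x := fun N =>
      Summit.AtomisticToContinuum.HydrodynamicLimit.Theorems.MourreKoopmanChargesStressStrongMixing.torusStressMoment_zero
        σ hhalf θ hθ Φ χ₁ χ₂ hχ₁ hχ₂ N
    simp only [hc0]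
    rw [funext hconst]
    exact tendsto_const_nhds

end Summit.AtomisticToContinuum.HydrodynamicLimit.Theorems.MourreKoopmanChargesStressStrongMixingSplit
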